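import Summits.QuantumFields.YangMills.Theorems.BalabanUVNodesN15DefectKernel
import Summits.QuantumFields.YangMills.Theorems.BalabanUVNodesN15RiemannKernel

/-!
# Route «BalabanUVNodes» (K4 «SpineRates»), node N15 = NE2, BACKGROUND LAYER — THE WIRE: the `U ≡ 1` input (binder (a) of the background step)
# INHABITED with a non-degenerate pairing (`M ≥ 2`) by discretised Lipschitz kernels on finite windows of `ℤ^d` (model level, no decay)

Cell `pub-ymgap`, seat `pub-ymgap-dag-n15-b` (D-0062; `bears_on: R4∕N15`; `--supports stmt-QuantumFields-19351 --as helper`).  THE JOIN of three hands on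
node N15's background layer (announced [DAGN15B-G0-DIFF-1]): dag-n20-b's p411695 `…N15.RiemannKernel.abs_blockSum_fineKernel_sub_coarseKernel_le_eta`
(the block Riemann sum of a discretised Lipschitz kernel: `|Σ_{u′∈B(u)} η′^d k(η′(x′−u′)) − η^d k(η(⌊x′∕M⌋−u))| ≤ Lip·η^{d+1}`), dag-n15-a g2's p411666
`…N15.DefectKernel.idef_pull_pull_single_apply` ∕ `hasMaj_ofBlocks_of_entry_le` (defect entries ⟹ block majorants), and this seat's background step
`…N15.BackgroundStep.idef_background_propagator_majorant` (p409422), whose binder (a) — a block majorant of the `U ≡ 1` defect `𝔇(G₁′, G₁)` under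
the piecewise-constant pull-back — is here INHABITED for the first time with spacing ratio `M ≥ 2` (the -a knit's torus inhabitants have the identity
pairing, ref-B READ #5): on a finite coarse window `Ω ⊂ ℤ^d` and the fine window `Ω′ = ⋃_{u∈Ω} B(u)` of its blocks (prelude `QuantumLattice.blockSites`),
for the kernel operators `K′(x′,u′) = η′^d k(η′(x′ − u′))` on `Ω′` and `K(x,u) = η^d k(η(x − u))` on `Ω` (`η = Mη′`, `k` Lipschitz for the sup norm),
`𝔇(K′, K) = K′∘pull π − pull π∘K` (`π = ⌊·∕M⌋ = T4EtaRateCoeffDefect.blockProj`) has the block majorant `Lip·η^{d+1}` between the sharp cube norms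
(coarse cubes = single sites, fine cubes = blocks; zero-range model geometry `siteGeo`) — `hasMaj_idef_riemannKernel`.  RATE READING: the coarse
kernel's own entries are `≤ η^d·sup|k|`, so the defect is the operator's size times `η·Lip∕sup|k|` = ONE rate factor `η∕ℓ` with `ℓ = sup|k|∕Lip` the
kernel's length scale (`entry_coarseKernel_le`) — King's (4.1)–(4.4)∕(3.73) mechanism in position space, at model level.

CONTENTS ([folklore]; 4 plumbing defs).  §1 the windows (`fineWindow`, `blockProjW`), the zero-range site geometry `siteGeo`, the kernel matrices
`fineKernel`∕`coarseKernel`; §2 the fibre of the window projection is the whole block (`sum_fibre_blockProjW`), the defect entry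
(`idef_entry_riemann`); §3 the inhabitant `hasMaj_idef_riemannKernel` (+ `entry_coarseKernel_le`).

HONEST FRAMING ∕ LIMITS.  MODEL LEVEL: discretised continuum kernels, global Lipschitz constant, NO decay (`ρ = 0`, zero-range geometry), finite windows;
nothing of [B9]∕King asserted; not Bałaban's propagators.  NE2⁺ NOT PRINTED, NOT proved; count-neutral (typed 28∕28 · discharged 0∕28); nothing continuum ∕
ℝ⁴ ∕ OS ∕ mass-gap ∕ Clay.
-/

noncomputable section

namespace Summit.QuantumFields.YangMills.BalabanUVNodes.N15.RiemannWire

open Literature.MathematicalPhysics.QuantumFieldTheory.Balaban1983to89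
open Literature.MathematicalPhysics.QuantumFieldTheory.Balaban1983to89.B11SectG (BlockNorm HasMaj)
open Literature.MathematicalPhysics.QuantumFieldTheory.Balaban1983to89.T4EtaRateDefect (idef)
open Literature.MathematicalPhysics.QuantumFieldTheory.Balaban1983to89.T4EtaRateCoeffDefect (pull pull_apply fibre mem_fibre blockProj
  blockProj_val)
open Literature.MathematicalPhysics.QuantumLattice (blockMap blockSites mem_blockSites_iff)
open Literature.Probability.LatticeModels (Site)
open Summit.QuantumFields.YangMills.BalabanUVNodes.N15.DefectKernel (idef_pull_pull_single_apply hasMaj_ofBlocks_of_entry_le)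
open Summit.QuantumFields.YangMills.BalabanUVNodes.N15.RiemannKernel (abs_blockSum_fineKernel_sub_coarseKernel_le_eta)

variable {d : ℕ} (M : ℕ) [NeZero M] (Ω : Finset (Site d))

/-! ## §1 Windows, the zero-range site geometry, the kernel matrices -/

/-- THE FINE WINDOW of a coarse window `Ω`: the union of the blocks `B(u)`, `u ∈ Ω`. [folklore] -/
def fineWindow : Finset (Site d) := Ω.biUnion (blockSites M)

/-- A fine site lies in the fine window iff its block lies in the coarse window. [folklore] -/
theorem mem_fineWindow_iff (x : Site d) : x ∈ fineWindow M Ω ↔ blockMap M x ∈ Ω := by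
  unfold fineWindow
  rw [Finset.mem_biUnion]
  constructor
  · rintro ⟨u, hu, hx⟩
    rwa [(mem_blockSites_iff M u x).1 hx]
  · intro h
    exact ⟨blockMap M x, h, (mem_blockSites_iff M _ x).2 rfl⟩

/-- The block projection of the fine window onto the coarse window (`T4EtaRateCoeffDefect.blockProj`). [folklore] -/
def blockProjW : {x // x ∈ fineWindow M Ω} → {y // y ∈ Ω} :=
  blockProj M (fineWindow M Ω) Ω fun x hx => (mem_fineWindow_iff M Ω x).1 hx

/-- Its value is `⌊x∕M⌋`. [folklore] -/
@[simp] theorem blockProjW_val (x : {x // x ∈ fineWindow M Ω}) : ((blockProjW M Ω x : {y // y ∈ Ω}) : Site d) = blockMap M x.1 := rfl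

/-- THE ZERO-RANGE SITE GEOMETRY on a finite type `X` (every site its own cube, all distances `0`, lengths `1`): the model geometry in which a block
majorant is a plain operator bound (no decay claimed). [folklore] -/
@[reducible] def siteGeo (X : Type) [Fintype X] : B6.Geometry where
  Site := X
  fin := inferInstance
  scale := fun _ => 0
  dist := fun _ _ => 0
  k := 0
  eta := 1
  L := 1
  R := 1
  M := 1
  Hyp21_22 := True
  Loc := Unit
  suppIn := fun _ _ => True
  supNorm := fun _ => 0
  l2Norm := fun _ => 0
  holder := fun _ _ => 0
  Cut := Unit
  cutIn := fun _ _ => True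
  cutH := fun _ _ => 0
  cutSup := fun _ => 0

/-- THE FINE KERNEL `K′(x′,u′) = η′^d·k(η′·(x′ − u′))` on the fine window. [folklore] -/
def fineKernel (k : (Fin d → ℝ) → ℝ) (η' : ℝ) : Matrix {x // x ∈ fineWindow M Ω} {x // x ∈ fineWindow M Ω} ℝ :=
  fun x' u' => η' ^ d * k (η' • fun i => ((x'.1 - u'.1) i : ℝ))

/-- THE COARSE KERNEL `K(x,u) = η^d·k(η·(x − u))` on the coarse window. [folklore] -/
def coarseKernel (k : (Fin d → ℝ) → ℝ) (η : ℝ) : Matrix {y // y ∈ Ω} {y // y ∈ Ω} ℝ :=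
  fun x u => η ^ d * k (η • fun i => ((x.1 - u.1) i : ℝ))

/-- Entries of a kernel operator: `(mulVecLin K)(δ_j)(i) = K i j`. [folklore] -/
theorem mulVecLin_single {m n : Type} [Fintype n] [DecidableEq n] (K : Matrix m n ℝ) (j : n) (i : m) :
    Matrix.mulVecLin K (Pi.single j (1 : ℝ)) i = K i j := by
  simp only [Matrix.mulVecLin_apply, Matrix.mulVec, dotProduct, Pi.single_apply, mul_ite, mul_one, mul_zero,
    Finset.sum_ite_eq', Finset.mem_univ, if_true]

/-! ## §2 The fibre of the window projection is the whole block; the defect entry -/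

/-- The fibre of `⌊·∕M⌋` over a coarse window site, read in `ℤ^d`, is the whole block `B(u)`. [folklore] -/
theorem map_fibre_blockProjW (u : {y // y ∈ Ω}) :
    (fibre (blockProjW M Ω) u).map (Function.Embedding.subtype _) = blockSites M u.1 := by
  ext v
  rw [Finset.mem_map]
  constructor
  · rintro ⟨x, hx, rfl⟩
    rw [mem_fibre] at hx
    rw [mem_blockSites_iff]
    have := congrArg Subtype.val hx
    simpa using this
  · intro hv
    have hvu : blockMap M v = u.1 := (mem_blockSites_iff M u.1 v).1 hv
    have hvΩ : v ∈ fineWindow M Ω := (mem_fineWindow_iff M Ω v).2 (hvu ▸ u.2)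
    refine ⟨⟨v, hvΩ⟩, ?_, rfl⟩
    rw [mem_fibre]
    exact Subtype.ext hvu

/-- Sums over the fibre are sums over the block. [folklore] -/
theorem sum_fibre_blockProjW (u : {y // y ∈ Ω}) (f : Site d → ℝ) :
    ∑ x ∈ fibre (blockProjW M Ω) u, f x.1 = ∑ v ∈ blockSites M u.1, f v := by
  rw [← map_fibre_blockProjW M Ω u, Finset.sum_map]
  rfl

/-- **THE DEFECT ENTRY**: `𝔇(K′,K)(δ_u)(x′) = Σ_{u′∈B(u)} η′^d k(η′(x′ − u′)) − η^d k(η(⌊x′∕M⌋ − u))`. [folklore] -/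
theorem idef_entry_riemann (k : (Fin d → ℝ) → ℝ) (η' η : ℝ) (u : {y // y ∈ Ω}) (x' : {x // x ∈ fineWindow M Ω}) :
    idef (pull (blockProjW M Ω)) (pull (blockProjW M Ω)) (Matrix.mulVecLin (fineKernel M Ω k η'))
        (Matrix.mulVecLin (coarseKernel Ω k η)) (Pi.single u 1) x' =
      (∑ u' ∈ blockSites M u.1, η' ^ d * k (η' • fun i => ((x'.1 - u') i : ℝ))) -
        η ^ d * k (η • fun i => ((blockMap M x'.1 - u.1) i : ℝ)) := by
  rw [idef_pull_pull_single_apply]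
  have h1 : ∀ z' : {x // x ∈ fineWindow M Ω}, Matrix.mulVecLin (fineKernel M Ω k η') (Pi.single z' 1) x' =
      (fun v : Site d => η' ^ d * k (η' • fun i => ((x'.1 - v) i : ℝ))) z'.1 := fun z' => by
    rw [mulVecLin_single]
    rfl
  have h2 : Matrix.mulVecLin (coarseKernel Ω k η) (Pi.single u 1) (blockProjW M Ω x') =
      η ^ d * k (η • fun i => ((blockMap M x'.1 - u.1) i : ℝ)) := by
    rw [mulVecLin_single]
    rfl
  rw [h2, Finset.sum_congr rfl fun z' _ => h1 z']
  have hs := sum_fibre_blockProjW M Ω u (fun v => η' ^ d * k (η' • fun i => ((x'.1 - v) i : ℝ)))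
  convert congrArg (fun t : ℝ => t - η ^ d * k (η • fun i => ((blockMap M x'.1 - u.1) i : ℝ))) hs using 2

/-! ## §3 The inhabitant of binder (a) with a non-degenerate pairing -/

/-- **BINDER (a) INHABITED (model level, `M ≥ 2` allowed).**  For `k` Lipschitz (`|k a − k b| ≤ Lip·‖a − b‖`, sup norm, `Lip ≥ 0`), `η′ ≥ 0`,
`η = Mη′`: the η-defect `𝔇(K′, K) = K′∘pull π − pull π∘K` of the discretised kernel operators on the windows has the block majorant `Lip·η^{d+1}`
from the single-site cubes of the coarse window to the blocks of the fine window (zero-range geometry: a plain operator bound, no decay claimed) —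
the hypothesis `hDG`∕`hNG` of `…N15.BackgroundStep.idef_background_propagator_majorant` at `w ≡ 1`, `N_G ≡ Lip·η^{d+1}`. [folklore] -/
theorem hasMaj_idef_riemannKernel (k : (Fin d → ℝ) → ℝ) {Lip : ℝ} (hLip : 0 ≤ Lip) (hk : ∀ a b, |k a - k b| ≤ Lip * ‖a - b‖)
    {η' η : ℝ} (hη' : 0 ≤ η') (hη : η = (M : ℝ) * η') :
    HasMaj (BlockNorm.ofBlocks (siteGeo {y // y ∈ Ω}) (fun y => y)) (BlockNorm.ofBlocks (siteGeo {y // y ∈ Ω}) (blockProjW M Ω))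
      (idef (pull (blockProjW M Ω)) (pull (blockProjW M Ω)) (Matrix.mulVecLin (fineKernel M Ω k η'))
        (Matrix.mulVecLin (coarseKernel Ω k η)))
      (fun _ _ => ((1 : ℕ) : ℝ) * (Lip * η ^ (d + 1))) := by
  refine hasMaj_ofBlocks_of_entry_le (g := siteGeo {y // y ∈ Ω}) (fun y => y) (blockProjW M Ω)
    (κ := fun _ _ => Lip * η ^ (d + 1)) (n₀ := 1) (fun _ _ => ?_) (fun y' => ?_) fun x' u => ?_
  · subst hη
    exact mul_nonneg hLip (pow_nonneg (mul_nonneg (Nat.cast_nonneg M) hη') _)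
  · -- the fibre of the identity over `y′` is `{y′}`
    have : fibre (fun y : {y // y ∈ Ω} => y) y' = {y'} := by
      ext z
      rw [mem_fibre, Finset.mem_singleton]
    rw [this, Finset.card_singleton]
  · rw [idef_entry_riemann]
    exact abs_blockSum_fineKernel_sub_coarseKernel_le_eta k hLip hk M hη' hη x'.1 u.1

/-- THE RATE READING's other side: the coarse kernel's own entries are `≤ η^d·B` when `|k| ≤ B` (`η ≥ 0`) — so the defect `Lip·η^{d+1}` is the
operator's size times `η·Lip∕B` = ONE rate factor `η∕ℓ`, `ℓ = B∕Lip` the kernel's length scale. [folklore] -/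
theorem entry_coarseKernel_le (k : (Fin d → ℝ) → ℝ) {B η : ℝ} (hη : 0 ≤ η) (hB : ∀ a, |k a| ≤ B) (x u : {y // y ∈ Ω}) :
    |coarseKernel Ω k η x u| ≤ η ^ d * B := by
  unfold coarseKernel
  rw [abs_mul, abs_of_nonneg (pow_nonneg hη d)]
  exact mul_le_mul_of_nonneg_left (hB _) (pow_nonneg hη d)

end Summit.QuantumFields.YangMills.BalabanUVNodes.N15.RiemannWire
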